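import Summits.Ventures.PercRepro.GenQColoopBridge
import Summits.Ventures.PercRepro.GenQOpenLayersCore

/-!
# PercRepro — the Core-typed layers of EVERY level reduce to the coloop-free flats (night-4, gen 2; RULING (rm)(4)(ii))

`GenQSevenFiveColoopFree.lean` does it at `(7, 5)`; this file does it at every level `q + 1 ≥ 3`: by the coloop bridge
(`GenQColoopBridge.lean`) a rank-`(q + 1)` flat with a coloop is «hyperplane + one point», so its balances are the signed trace
sums on a rank-`q` subset of the same Core matroid.

* `OpenLayersCoreFree q` — `OpenLayersCore q` with the extra hypothesis `mTr M G = 0` (coloop-free flats);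
* `TraceSumsCore q` — the trace sums of level `q + 1` at every type `t ≤ q` on the rank-`q` subsets of Core matroids of
  rank `q + 3`;
* `openLayersCore_succ_of_free : 2 ≤ q → TraceSumsCore q → OpenLayersCoreFree (q + 1) → OpenLayersCore (q + 1)`, and
  `rls_succ_succ_of_free`: the row `(q + 2, q)` on every finite matroid from the coloop-free layers and the trace sums of
  the levels `5 … q`.
-/

namespace PercRepro.GenQ

open Finset ThmH PerFlat SixFour ThmN NightThree

/-- **The Core-typed layers on the coloop-free flats** (`mTr M G = 0`). -/
def OpenLayersCoreFree (q : ℕ) : Prop :=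
  ∀ {β : Type} [DecidableEq β] (M : Matroid β) [M.Finite] (G : Finset β), Core M (q + 2) → G ∈ flatsQ M q →
    TwoHyp M G q → mTr M G = 0 →
      (6 ≤ q → q + 2 ≤ G.card → (G.card - q) * (q + 3) + 1 < q * q → 0 ≤ Jq M G q 1) ∧
      ((G.card - q) * (G.card - q + 3) < 12 * (q - 1) → 0 ≤ Jq M G q 2) ∧
      (∀ t, 3 ≤ t → t + 1 ≤ q → 0 ≤ Jq M G q t)

/-- **The trace sums of level `q + 1`** at every type `t ≤ q` on the rank-`q` subsets of Core matroids of rank `q + 3`. -/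
def TraceSumsCore (q : ℕ) : Prop :=
  ∀ {β : Type} [DecidableEq β] (M : Matroid β) [M.Finite] (H : Finset β), Core M (q + 1 + 2) → H ⊆ gr M →
    M.eRk (H : Set β) = (q : ℕ∞) → ∀ t, t ≤ q →
    0 ≤ ∑ B ∈ Rq M H q, ((((q + 1 : ℕ) : ℚ) + 2 - t) * (1 / (2 + (mTr M B : ℚ))) -
      ((((q + 1 : ℕ) : ℚ) + 2) / (((q + 1 : ℕ) : ℚ) + 1)) * dem M H t B)

/-- **The Core-typed layers of level `q + 1` from the coloop-free flats and the trace sums** (`q ≥ 2`). -/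
theorem openLayersCore_succ_of_free {q : ℕ} (hq : 2 ≤ q) (htr : TraceSumsCore q) (hfree : OpenLayersCoreFree (q + 1)) :
    OpenLayersCore (q + 1) := by
  intro β _ M _ G hc hG hF
  by_cases hm : mTr M G = 0
  · exact hfree M G hc hG hF hm
  · have hGg : G ⊆ gr M := (mem_flatsQ.1 hG).1
    have hr : M.eRk (G : Set β) = ((q + 1 : ℕ) : ℕ∞) := (mem_flatsQ.1 hG).2.2
    obtain ⟨a, ha, hacl⟩ := exists_coloop_of_mTr_ne_zero hm
    have hτ : M.eRk ((G.erase a : Finset β) : Set β) = (q : ℕ∞) := eRk_erase_of_coloop hGg ha hr hacl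
    have hτg : G.erase a ⊆ gr M := (Finset.erase_subset a G).trans hGg
    have key : ∀ t, t ≤ q → 0 ≤ Jq M G (q + 1) t := fun t ht =>
      Jq_nonneg_of_coloop_of_trace hGg ha hr hacl t (htr M (G.erase a) hc hτg hτ t ht)
    exact ⟨fun _ _ _ => key 1 (by omega), fun _ => key 2 (by omega), fun t _ ht => key t (by omega)⟩

/-- **The row `(q + 2, q)` on every finite matroid from the coloop-free layers and the trace sums of the levels
`5 … q`** (`q ≥ 3`). -/
theorem rls_succ_succ_of_free {α : Type} [DecidableEq α] (q : ℕ) (hq : 3 ≤ q)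
    (htr : ∀ q', 4 ≤ q' → q' + 1 ≤ q → TraceSumsCore q')
    (hfree : ∀ q', 5 ≤ q' → q' ≤ q → OpenLayersCoreFree q') : ∀ (M : Matroid α) [M.Finite], RLS M (q + 2) q := by
  apply rls_succ_succ_of_openLayersCore q hq
  intro q' hq'5 hq'q
  obtain ⟨p, rfl⟩ : ∃ p, q' = p + 1 := ⟨q' - 1, by omega⟩
  exact openLayersCore_succ_of_free (by omega) (htr p (by omega) (by omega)) (hfree (p + 1) hq'5 hq'q)

end PercRepro.GenQ
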